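import Summits.Ventures.LatticeQCDFlow.Scaling.TightSectorKLogKFloor
import Summits.Ventures.LatticeQCDFlow.Scaling.TightSectorWitness
import Summits.Ventures.LatticeQCDFlow.Scaling.DominatedStarRegimeFreeTimeAverages

/-!
HONEST FRAMING: exact (Metropolis-corrected) sampling algorithms for lattice gauge theory; figures
of merit are autocorrelation/cost numbers at stated couplings and volumes; no continuum-physics
claim.

# TightSectorKLogKLaw — THE `log K` WITH THE MAP QUALITY, ASSEMBLED: `d(n) ≥ 1 − (1 + t·ĉ·p'·q'/m)ⁿ/(K+1) − Kθ` AND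
# `t_mix(ε) ≥ (m/(t·ĉ·p'·q'))·log((K+1)(1−ε−Kθ))` FROM THE PLANTED START, FOR EVERY HOT SAMPLER AND ALLOCATION; ON THE TWO-POINT WITNESS
# (`p' = p`, `q' ≤ 1`) `t_mix(ε) ≥ (m/(t·ĉ·p))·log((K+1)(1−ε−Kθ))` — THE SWAP BUDGET'S COUPON COLLECTOR IS LINEAR IN `1/p` (lean-2 GEN-29, ours)

Venture-side (OURS).  Cell `lqcd-flow` (pub-lqcd), unit `pub-lqcd-lean-2-g29`, 2026-08-28.  Chapter O (the floor sees the map quality), file 8: the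
distance and mixing-time consequences of `Scaling/TightSectorKLogKFloor` (O7: the cold count `V` is skip-free and drops at rate `≤ t·ĉ·p'·q'/m`) through
`Scaling/SkipFreeCountFloor` (O6), the union bound `π̃(V ≥ 1) ≤ Σ_k μ_{k+1}(A) ≤ Kθ`, chapter N's convergence for the exact hot sampler, and the
discharge on the two-point witness of `Scaling/TightSectorWitness` (O4), where pointwise tightness holds with `p' = p` and the light-side ratio is
`q' = (1−θ)/(1−pθ) ≤ 1`.

## What is proved

* `coldLabel_mass_le` — `π̃(V ≥ 1) ≤ Kθ` when every cold level gives `A` mass `≤ θ`.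
* **`tightSector_worstTvDist_ge_klogk`** — `d(n) ≥ 1 − (1 + t·ĉ·p'·q'/m)ⁿ/(V(x)+1) − Kθ` (any hot kernel, any allocation).
* **`tightSector_mixingTime_ge_klogk`** — planted start, `ε + Kθ < 1`, `ε`-close at some time: **`t_mix(ε) ≥ (m/(t·ĉ·p'·q'))·log((K+1)(1−ε−Kθ))`**;
  **`dominatedStar_mixingTime_ge_klogk`** — the closeness discharged for exact hot redraws under one-sided domination.
* **`boolWitness_mixingTime_ge_klogk`** — on the witness (cold laws `(θ,1−θ)`, hot law `(pθ,1−pθ)`, identity maps, idle cold replicas, exact hot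
  redraws): **`t_mix(ε) ≥ (m/(t·ĉ·p))·log((K+1)(1−ε−Kθ))`** for every hub list with multiplicities in `[c, ĉ]`, `0 < t < 1`, `w_0 > 0`.

Reading (no numerics implied): with O3 (`(m/(t·c_k·p') − 1)·log(1/(2ε))`) and O2 (`((1−θ)K/(p'·min{t,(1−t)w_0}) − 1)·log(1/(2ε))`) the cold-start floor of
the map-assisted hub now reads, on its swap budget, `(m/(t·ĉ·p))·log K` on a quality-`p` instance — the coupon collector's logarithm times the inverse
quality —, against chapter N's ceilings `(K/(p·min{…}))·log(1/π̃_min)`; OPEN-MATH items 7/8 are closed on the floor side for the swap budget.  Still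
open: the refresh budget's `(K/((1−t)w_0·p))·log K` (the count must follow a label through the hub), and item 1.  NOT CLAIMED: anything measured.
Literature grade (cell rule): OWN COMPOSITION (O6 + O7 + O4 + N8); nothing cited as a fact; no new bib keys.
-/

noncomputable section

open Finset Function
open Literature.Probability.MarkovChains

namespace Summit.Ventures.LatticeQCDFlow.Scaling

variable {S : Type*} [Fintype S] [DecidableEq S] {K m : ℕ} {μ : Fin (K + 1) → S → ℝ} {M : Fin (K + 1) → S → S → ℝ}
  {w : Fin (K + 1) → ℝ} {t p : ℝ}

/-! ## §1 The union bound for the planted labels under `π̃` -/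

/-- **`π̃(some cold replica in A) ≤ K·θ`** when every cold level gives `A` mass `≤ θ`. [ours] -/
theorem coldLabel_mass_le (hμ : ∀ k x, 0 < μ k x) (hμ1 : ∀ k, ∑ u, μ k u = 1) {A : Finset S} {θ : ℝ}
    (hθ : ∀ k : Fin K, ∑ u ∈ A, μ k.succ u ≤ θ) :
    ∑ y ∈ univ.filter (fun y : Fin (K + 1) → S => 0 < (univ.filter (fun k : Fin K => y k.succ ∈ A)).card), tensorFun μ y ≤ K * θ := by
  rw [Finset.sum_filter]
  have hpt : ∀ y : Fin (K + 1) → S, (if 0 < (univ.filter (fun k : Fin K => y k.succ ∈ A)).card then tensorFun μ y else 0)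
      ≤ tensorFun μ y * ∑ k : Fin K, (if y k.succ ∈ A then (1 : ℝ) else 0) := by
    intro y
    split_ifs with h
    · obtain ⟨k, hk⟩ := Finset.card_pos.mp h
      have hk' := (mem_filter.mp hk).2
      have h1 : (1 : ℝ) ≤ ∑ k : Fin K, (if y k.succ ∈ A then (1 : ℝ) else 0) := by
        have := single_le_sum (f := fun k : Fin K => if y k.succ ∈ A then (1 : ℝ) else 0)
          (fun k _ => by split_ifs <;> norm_num) (mem_univ k)
        rwa [if_pos hk'] at this
      nlinarith [tensorFun_pos hμ y]
    · exact mul_nonneg (tensorFun_pos hμ y).le (sum_nonneg fun k _ => by split_ifs <;> norm_num)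
  refine (sum_le_sum fun y _ => hpt y).trans ?_
  simp_rw [Finset.mul_sum]
  rw [Finset.sum_comm]
  have hk : ∀ k : Fin K, ∑ y : Fin (K + 1) → S, tensorFun μ y * (if y k.succ ∈ A then (1 : ℝ) else 0) ≤ θ := by
    intro k
    rw [sum_tensorFun_mul_apply μ hμ1 k.succ (fun u => if u ∈ A then (1 : ℝ) else 0)]
    simp_rw [mul_ite, mul_one, mul_zero]
    rw [← Finset.sum_filter, show univ.filter (fun u => u ∈ A) = A by ext; simp]
    exact hθ k
  calc ∑ k : Fin K, ∑ y : Fin (K + 1) → S, tensorFun μ y * (if y k.succ ∈ A then (1 : ℝ) else 0)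
      ≤ ∑ k : Fin K, θ := sum_le_sum fun k _ => hk k
    _ = K * θ := by rw [sum_const, Finset.card_univ, Fintype.card_fin, nsmul_eq_mul]

/-! ## §2 The floors for every hot sampler and allocation -/

section Star
variable (κ : Fin m → Fin K) (φ : Fin m → Equiv.Perm S)

/-- **`d(n) ≥ 1 − (1 + t·ĉ·p'·q'/m)ⁿ/(V(x)+1) − Kθ`** when every cold level gives `A` mass `≤ θ` (union bound under `π̃`). [ours] -/
theorem tightSector_worstTvDist_ge_klogk (hm : 1 ≤ m) (hμ : ∀ k x, 0 < μ k x) (hμ1 : ∀ k, ∑ u, μ k u = 1)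
    (hM : ∀ k, IsRowStochastic (M k)) (hw0 : ∀ k, 0 ≤ w k) (hw1 : ∑ k, w k = 1) (ht0 : 0 ≤ t) (ht1 : t ≤ 1) {A : Finset S}
    (hφA : ∀ r u, φ r u ∈ A ↔ u ∈ A) {p' q' : ℝ} (hp' : 0 ≤ p') (hq' : 0 ≤ q')
    (htight : ∀ r, ∀ z ∈ A, μ 0 ((φ r).symm z) ≤ p' * μ (κ r).succ z)
    (hlight : ∀ r, ∀ u ∉ A, μ (κ r).succ (φ r u) ≤ q' * μ 0 u)
    (hidle : ∀ k : Fin (K + 1), k ≠ 0 → w k * edgeMeasure (μ k) (M k) A Aᶜ = 0)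
    {cmax : ℕ} (hc : ∀ k : Fin K, (univ.filter (fun r : Fin m => κ r = k)).card ≤ cmax)
    {θ : ℝ} (hθ : ∀ k : Fin K, ∑ u ∈ A, μ k.succ u ≤ θ) (x : Fin (K + 1) → S) (n : ℕ) :
    1 - (1 + t * cmax * p' * q' / m) ^ n / (((univ.filter (fun k : Fin K => x k.succ ∈ A)).card : ℝ) + 1) - K * θ
      ≤ worstTvDist (fun a b : Fin (K + 1) → S =>
          t * ptGraphSwap μ (fun r : Fin m => (((0 : Fin (K + 1)), (κ r).succ) : Fin (K + 1) × Fin (K + 1))) φ a b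
            + (1 - t) * prodKernel w M a b) (tensorFun μ) n := by
  have hmpos : (0 : ℝ) < m := Nat.cast_pos.mpr (by omega)
  have hP := weightedScheme_isRowStochastic (t := t) (w := w)
    (ptGraphSwap_isRowStochastic (e := fun r : Fin m => (((0 : Fin (K + 1)), (κ r).succ) : Fin (K + 1) × Fin (K + 1))) (φ := φ) hμ)
    hM hw0 hw1 ht0 ht1
  have hunion := coldLabel_mass_le (K := K) hμ hμ1 hθ
  exact skipFree_worstTvDist_ge hP (fun y => (univ.filter (fun k : Fin K => y k.succ ∈ A)).card)
    (fun a b hab => tightSector_coldCount_skipFree κ φ (M := M) hμ hφA a b hab) (by positivity)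
    (fun a => tightSector_coldCount_drop_le κ φ hm hμ hM ht0 hφA hp' hq' htight hlight hidle hc a)
    (sum_tensorFun_eq_one μ hμ1) hunion x n

/-- **THE `log K` WITH THE QUALITY: `t_mix(ε) ≥ (m/(t·ĉ·p'·q'))·log((K+1)(1−ε−Kθ))`** from the planted start (every cold replica in `A`), for EVERY
hot sampler and allocation (`0 < t ≤ 1`, `ĉ ≥ 1`, `p', q' > 0`, `ε + Kθ < 1`, the chain `ε`-close to `π̃` at some time). [ours] -/
theorem tightSector_mixingTime_ge_klogk (hm : 1 ≤ m) (hμ : ∀ k x, 0 < μ k x) (hμ1 : ∀ k, ∑ u, μ k u = 1)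
    (hM : ∀ k, IsRowStochastic (M k)) (hw0 : ∀ k, 0 ≤ w k) (hw1 : ∑ k, w k = 1) (ht0 : 0 < t) (ht1 : t ≤ 1) {A : Finset S}
    (hφA : ∀ r u, φ r u ∈ A ↔ u ∈ A) {p' q' : ℝ} (hp' : 0 < p') (hq' : 0 < q')
    (htight : ∀ r, ∀ z ∈ A, μ 0 ((φ r).symm z) ≤ p' * μ (κ r).succ z)
    (hlight : ∀ r, ∀ u ∉ A, μ (κ r).succ (φ r u) ≤ q' * μ 0 u)
    (hidle : ∀ k : Fin (K + 1), k ≠ 0 → w k * edgeMeasure (μ k) (M k) A Aᶜ = 0)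
    {cmax : ℕ} (hc1 : 1 ≤ cmax) (hc : ∀ k : Fin K, (univ.filter (fun r : Fin m => κ r = k)).card ≤ cmax)
    {θ : ℝ} (hθ : ∀ k : Fin K, ∑ u ∈ A, μ k.succ u ≤ θ) (x : Fin (K + 1) → S) (hx : ∀ k : Fin K, x k.succ ∈ A)
    {ε : ℝ} (hε : ε + K * θ < 1)
    (hmix : ∃ n, worstTvDist (fun a b : Fin (K + 1) → S =>
          t * ptGraphSwap μ (fun r : Fin m => (((0 : Fin (K + 1)), (κ r).succ) : Fin (K + 1) × Fin (K + 1))) φ a b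
            + (1 - t) * prodKernel w M a b) (tensorFun μ) n ≤ ε) :
    m / (t * cmax * p' * q') * Real.log (((K : ℝ) + 1) * (1 - ε - K * θ))
      ≤ (mixingTime (fun a b : Fin (K + 1) → S =>
          t * ptGraphSwap μ (fun r : Fin m => (((0 : Fin (K + 1)), (κ r).succ) : Fin (K + 1) × Fin (K + 1))) φ a b
            + (1 - t) * prodKernel w M a b) (tensorFun μ) ε : ℝ) := by
  have hmpos : (0 : ℝ) < m := Nat.cast_pos.mpr (by omega)
  have hcpos : (0 : ℝ) < cmax := Nat.cast_pos.mpr (by omega)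
  have hP := weightedScheme_isRowStochastic (t := t) (w := w)
    (ptGraphSwap_isRowStochastic (e := fun r : Fin m => (((0 : Fin (K + 1)), (κ r).succ) : Fin (K + 1) × Fin (K + 1))) (φ := φ) hμ)
    hM hw0 hw1 ht0.le ht1
  have hVx : (univ.filter (fun k : Fin K => x k.succ ∈ A)).card = K := by
    rw [Finset.filter_true_of_mem (fun k _ => hx k), Finset.card_univ, Fintype.card_fin]
  have hunion := coldLabel_mass_le (K := K) hμ hμ1 hθ
  have hlam : 0 < t * cmax * p' * q' / m := by positivity
  have h := skipFree_mixingTime_ge hP (fun y => (univ.filter (fun k : Fin K => y k.succ ∈ A)).card)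
    (fun a b hab => tightSector_coldCount_skipFree κ φ (M := M) hμ hφA a b hab) hlam
    (fun a => tightSector_coldCount_drop_le κ φ hm hμ hM ht0.le hφA hp'.le hq'.le htight hlight hidle hc a)
    (sum_tensorFun_eq_one μ hμ1) hunion x (by linarith) hmix
  rw [hVx] at h
  rw [show (m : ℝ) / (t * cmax * p' * q') * Real.log (((K : ℝ) + 1) * (1 - ε - K * θ))
      = Real.log (((K : ℝ) + 1) * (1 - ε - K * θ)) / (t * cmax * p' * q' / m) by field_simp]
  exact h

/-- **The same with the closeness discharged for exact hot redraws under one-sided domination** (chapter N's convergence, `Scaling/DominatedStarRegimeFreeTimeAverages`):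
`K ≥ 1`, `0 < t < 1`, `w_0 > 0`, multiplicities between `c ≥ 1` and `ĉ`, `0 < p ≤ 1`, reversible cold kernels, `0 < ε`, `ε + Kθ < 1`. [ours] -/
theorem dominatedStar_mixingTime_ge_klogk [Nontrivial S] (hK : 1 ≤ K) (hm : 1 ≤ m) (ht0 : 0 < t) (ht1 : t < 1)
    (hw0 : ∀ k, 0 ≤ w k) (hw00 : 0 < w 0) (hw1 : ∑ k, w k = 1) (hμ : ∀ k x, 0 < μ k x) (hμ1 : ∀ k, ∑ u, μ k u = 1)
    (hM : ∀ k, IsRowStochastic (M k)) (hMrev : ∀ k, DetailedBalance (μ k) (M k)) (hM0 : ∀ u v, M 0 u v = μ 0 v)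
    (hp0 : 0 < p) (hp1 : p ≤ 1) (hdom : ∀ r u, p * μ (κ r).succ (φ r u) ≤ μ 0 u)
    {c : ℕ} (hc1 : 1 ≤ c) (hc : ∀ p' : Fin K, c ≤ (univ.filter (fun r : Fin m => κ r = p')).card)
    {cmax : ℕ} (hcmax : ∀ k : Fin K, (univ.filter (fun r : Fin m => κ r = k)).card ≤ cmax)
    {A : Finset S} (hφA : ∀ r u, φ r u ∈ A ↔ u ∈ A) {p' q' : ℝ} (hp' : 0 < p') (hq' : 0 < q')
    (htight : ∀ r, ∀ z ∈ A, μ 0 ((φ r).symm z) ≤ p' * μ (κ r).succ z)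
    (hlight : ∀ r, ∀ u ∉ A, μ (κ r).succ (φ r u) ≤ q' * μ 0 u)
    (hidle : ∀ k : Fin (K + 1), k ≠ 0 → w k * edgeMeasure (μ k) (M k) A Aᶜ = 0)
    {θ : ℝ} (hθ : ∀ k : Fin K, ∑ u ∈ A, μ k.succ u ≤ θ) (x : Fin (K + 1) → S) (hx : ∀ k : Fin K, x k.succ ∈ A)
    {ε : ℝ} (hε0 : 0 < ε) (hε : ε + K * θ < 1) :
    m / (t * cmax * p' * q') * Real.log (((K : ℝ) + 1) * (1 - ε - K * θ))
      ≤ (mixingTime (fun a b : Fin (K + 1) → S =>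
          t * ptGraphSwap μ (fun r : Fin m => (((0 : Fin (K + 1)), (κ r).succ) : Fin (K + 1) × Fin (K + 1))) φ a b
            + (1 - t) * prodKernel w M a b) (tensorFun μ) ε : ℝ) := by
  have hcm1 : 1 ≤ cmax := hc1.trans ((hc ⟨0, by omega⟩).trans (hcmax ⟨0, by omega⟩))
  obtain ⟨x₀, -, hx₀⟩ := Finset.exists_min_image (univ : Finset (Fin (K + 1) → S)) (tensorFun μ) univ_nonempty
  have hmix : ∃ n : ℕ, worstTvDist (fun a b : Fin (K + 1) → S =>
      t * ptGraphSwap μ (fun r : Fin m => (((0 : Fin (K + 1)), (κ r).succ) : Fin (K + 1) × Fin (K + 1))) φ a b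
        + (1 - t) * prodKernel w M a b) (tensorFun μ) n ≤ ε :=
    ⟨_, dominatedStar_worstTvDist_le_regimeFree κ φ hK hm ht0 ht1 hw0 hw00 hw1 hμ hμ1 hM hMrev hM0 hp0 hp1 hdom hc1 hc
      (tensorFun_pos hμ x₀) (fun y => hx₀ y (mem_univ y)) hε0 (Nat.le_ceil _)⟩
  exact tightSector_mixingTime_ge_klogk κ φ hm hμ hμ1 hM hw0 hw1 ht0 ht1.le hφA hp' hq' htight hlight hidle hcm1 hcmax hθ x hx hε hmix


/-! ## §3 The two-point witness: the `log K` with `1/p` is attained -/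

/-- **ON THE WITNESS `t_mix(ε) ≥ (m/(t·ĉ·p))·log((K+1)(1−ε−Kθ))`** (cold laws `(θ,1−θ)`, hot law `(pθ,1−pθ)`, identity maps, idle cold replicas,
exact hot redraws; every hub list with multiplicities in `[c, ĉ]`, `c ≥ 1`; `0 < t < 1`, `w ≥ 0`, `Σw = 1`, `w_0 > 0`, `0 < p ≤ 1`, `0 < θ < 1`,
`0 < ε`, `ε + Kθ < 1`; planted start: every cold replica at `⊤`). [ours] -/
theorem boolWitness_mixingTime_ge_klogk {θ : ℝ} (hK : 1 ≤ K) (hm : 1 ≤ m) (ht0 : 0 < t) (ht1 : t < 1) (hw0 : ∀ k, 0 ≤ w k)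
    (hw00 : 0 < w 0) (hw1 : ∑ k, w k = 1) (hp0 : 0 < p) (hp1 : p ≤ 1) (hθ0 : 0 < θ) (hθ1 : θ < 1)
    {c : ℕ} (hc1 : 1 ≤ c) (hc : ∀ p' : Fin K, c ≤ (univ.filter (fun r : Fin m => κ r = p')).card)
    {cmax : ℕ} (hcmax : ∀ k : Fin K, (univ.filter (fun r : Fin m => κ r = k)).card ≤ cmax)
    (x : Fin (K + 1) → Bool) (hx : ∀ k : Fin K, x k.succ = true) {ε : ℝ} (hε0 : 0 < ε) (hε : ε + K * θ < 1) :
    m / (t * cmax * p) * Real.log (((K : ℝ) + 1) * (1 - ε - K * θ))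
      ≤ (mixingTime (fun a b : Fin (K + 1) → Bool =>
              t * ptGraphSwap (fun (k : Fin (K + 1)) (b : Bool) =>
                    if k = 0 then (if b then p * θ else 1 - p * θ) else (if b then θ else 1 - θ))
                  (fun r : Fin m => (((0 : Fin (K + 1)), (κ r).succ) : Fin (K + 1) × Fin (K + 1)))
                  (fun _ : Fin m => Equiv.refl Bool) a b
                + (1 - t) * prodKernel w (fun (k : Fin (K + 1)) (u v : Bool) =>
                    if k = 0 then (if v then p * θ else 1 - p * θ) else (if u = v then (1 : ℝ) else 0)) a b)
            (tensorFun (fun (k : Fin (K + 1)) (b : Bool) =>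
              if k = 0 then (if b then p * θ else 1 - p * θ) else (if b then θ else 1 - θ))) ε : ℝ) := by
  have hpθ1 : p * θ < 1 := by nlinarith
  have hμ : ∀ (k : Fin (K + 1)) (b : Bool), 0 < (fun (k : Fin (K + 1)) (b : Bool) =>
      if k = 0 then (if b then p * θ else 1 - p * θ) else (if b then θ else 1 - θ)) k b := by
    intro k b
    by_cases hk : k = 0
    · simp only [hk, if_true]; split_ifs; exacts [mul_pos hp0 hθ0, by linarith]
    · simp only [hk, if_false]; split_ifs; exacts [hθ0, by linarith]
  have hμ1 : ∀ k : Fin (K + 1), ∑ u, (fun (k : Fin (K + 1)) (b : Bool) =>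
      if k = 0 then (if b then p * θ else 1 - p * θ) else (if b then θ else 1 - θ)) k u = 1 := by
    intro k
    by_cases hk : k = 0
    · simp only [hk, if_true]; exact sum_bool_law _
    · simp only [hk, if_false]; exact sum_bool_law _
  have hM := fun k : Fin (K + 1) => boolWitness_rowStochastic (K := K) hp0.le hp1 hθ0.le hθ1.le k
  have hMrev := fun k : Fin (K + 1) => boolWitness_detailedBalance (K := K) (p := p) (θ := θ) k
  have hM0 : ∀ u v : Bool, (fun (k : Fin (K + 1)) (u v : Bool) =>
      if k = 0 then (if v then p * θ else 1 - p * θ) else (if u = v then (1 : ℝ) else 0)) 0 u v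
      = (fun (k : Fin (K + 1)) (b : Bool) => if k = 0 then (if b then p * θ else 1 - p * θ) else (if b then θ else 1 - θ)) 0 v := by
    intro u v; simp only [if_true]
  have hdom := boolWitness_oneSided κ (K := K) (θ := θ) hp1
  have hφA : ∀ (r : Fin m) (u : Bool), (fun _ : Fin m => Equiv.refl Bool) r u ∈ ({true} : Finset Bool) ↔ u ∈ ({true} : Finset Bool) :=
    fun r u => Iff.rfl
  have hidle := fun (k : Fin (K + 1)) (hk : k ≠ 0) => boolWitness_idle (K := K) (w := w) (p := p) (θ := θ) k hk
  -- pointwise tightness with `p' = p` on `A = {⊤}`, light-side ratio `q' = 1`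
  have htight : ∀ r : Fin m, ∀ z ∈ ({true} : Finset Bool),
      (fun (k : Fin (K + 1)) (b : Bool) => if k = 0 then (if b then p * θ else 1 - p * θ) else (if b then θ else 1 - θ)) 0
          (((fun _ : Fin m => Equiv.refl Bool) r).symm z)
        ≤ p * (fun (k : Fin (K + 1)) (b : Bool) => if k = 0 then (if b then p * θ else 1 - p * θ) else (if b then θ else 1 - θ))
          (κ r).succ z := by
    intro r z hz
    rw [Finset.mem_singleton] at hz
    subst hz
    simp only [Equiv.refl_symm, Equiv.refl_apply, if_true, Fin.succ_ne_zero, if_false]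
    exact le_rfl
  have hlight : ∀ r : Fin m, ∀ u ∉ ({true} : Finset Bool),
      (fun (k : Fin (K + 1)) (b : Bool) => if k = 0 then (if b then p * θ else 1 - p * θ) else (if b then θ else 1 - θ)) (κ r).succ
          ((fun _ : Fin m => Equiv.refl Bool) r u)
        ≤ 1 * (fun (k : Fin (K + 1)) (b : Bool) => if k = 0 then (if b then p * θ else 1 - p * θ) else (if b then θ else 1 - θ)) 0 u := by
    intro r u hu
    rw [Finset.mem_singleton] at hu
    have hu' : u = false := by cases u; rfl; exact absurd rfl hu
    subst hu'
    simp only [Equiv.refl_apply, Fin.succ_ne_zero, if_false, if_true, Bool.false_eq_true, one_mul]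
    nlinarith
  have hθle : ∀ k : Fin K, ∑ u ∈ ({true} : Finset Bool), (fun (k : Fin (K + 1)) (b : Bool) =>
      if k = 0 then (if b then p * θ else 1 - p * θ) else (if b then θ else 1 - θ)) k.succ u ≤ θ := by
    intro k; simp only [Fin.succ_ne_zero, if_false]; exact (sum_sector_law θ).le
  have hxA : ∀ k : Fin K, x k.succ ∈ ({true} : Finset Bool) := fun k => Finset.mem_singleton.mpr (hx k)
  have h := dominatedStar_mixingTime_ge_klogk κ (fun _ : Fin m => Equiv.refl Bool) hK hm ht0 ht1 hw0 hw00 hw1 hμ hμ1 hM hMrev hM0 hp0 hp1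
    hdom hc1 hc hcmax hφA hp0 one_pos htight hlight hidle hθle x hxA hε0 hε
  rw [mul_one] at h
  exact h

end Star

end Summit.Ventures.LatticeQCDFlow.Scaling

end
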